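import Mathlib
import HarnessLib
import Summits.HubbardSuperconductivity.HubbardSuperconductivity.Theorems.KLProgrammeKLRegimeSplitThermalLayer

/-!
# Route `KLProgramme` — edge facts for the pair masses ACROSS TRANSFERS, XII: the SCALE BOOKKEEPING behind the shortfall row (D2) — the geometric sum over the
# DEEP scales, the count of the EDGE scales, and the shortfall `Σ_{j<m}(W_0(j) − W_q(j)) ≤ Θ` BY SHAPE

Cell gate-hubbard-kl, seat hubbard-kl-k3c1-p1 (g21; child-1 lineage).  Row 25b (`…TransferModulusComplDeep`) gives the per-scale transfer modulus
`|W_j(q) − W_j(0)| ≤ C·(|p_q|_𝕋/Λ_j)²` at the DEEP scales (`(4 + coeffNorm 1 K)·|p_q|_𝕋 ≤ Λ_j/16`); at the remaining in-class scales (the EDGE scales) the free envelope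
gives `|W| ≤ b`.  THIS FILE is the arithmetic that turns those into the shortfall constant `Θ` of S2-ROWS (D2) (`Λ_j = klScale klE0 j = 4^{-j}/32`):

* §1 **`klds_sum_sq_div_klScale_le`**: `Σ_{j ≤ J} (s/Λ_j)² ≤ (16/15)·(s/Λ_J)²` (the deep moduli are a geometric series dominated by the deepest term);
* §2 **`klds_edge_card_le`**: if `0 < v`, `512·v ≤ 4^{m₀}` then any set of scales `j` that are in class (`s ≤ 4^{-j}`) but not deep (`Λ_j/16 < v·s`) has at most `m₀` elements
  (two such scales differ by `< log₄(512 v)`);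
* §3 **`klds_shortfall_le`**: per-scale deep moduli `W_0(j) − W_q(j) ≤ C·(s/Λ_j)²` for `j ≤ J` and edge bounds `W_0(j) − W_q(j) ≤ 2b` for `J < j < m` give
  `Σ_{j<m}(W_0(j) − W_q(j)) ≤ (16/15)·C·(s/Λ_J)² + 2b·(m − (J+1))` — the (D2) shape `≤ Θ` with `Θ = (16/15)·C·(s/Λ_J)² + 2b·m₀` once the edge scales are `≤ m₀`
  (and `s/Λ_J ≤ 1/(16v)` at the deepest deep scale).

Pure real arithmetic; no definitions; nothing asserts any slot, stub, K3 or SC. [folklore]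
-/

noncomputable section

namespace Summit.HubbardSuperconductivity.HubbardSuperconductivity.Theorems.KLRegimeSplit

set_option linter.dupNamespace false -- summit = problem name (single-conjunct summit), D-0017

open Real Finset
open Summit.HubbardSuperconductivity.HubbardSuperconductivity.Theorems.KLProgrammeLegKernels

/-! ## §1 The geometric sum over the deep scales -/

/-- `(s/Λ_j)² = 1024·s²·16^j` (`Λ_j = 4^{-j}/32`). [folklore] -/
theorem klds_sq_div_klScale_eq (s : ℝ) (j : ℕ) : (s / klScale klE0 j) ^ 2 = 1024 * s ^ 2 * (16 : ℝ) ^ j := by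
  have h16 : (16 : ℝ) ^ j = ((4 : ℝ) ^ j) ^ 2 := by rw [← pow_mul, mul_comm, pow_mul]; norm_num
  simp only [klScale, klE0, h16]
  have h4 : (0 : ℝ) < (4 : ℝ) ^ j := by positivity
  field_simp
  ring

/-- **The deep moduli are a geometric series**: `Σ_{j ≤ J} (s/Λ_j)² ≤ (16/15)·(s/Λ_J)²`. [folklore] -/
theorem klds_sum_sq_div_klScale_le (s : ℝ) (J : ℕ) :
    ∑ j ∈ range (J + 1), (s / klScale klE0 j) ^ 2 ≤ 16 / 15 * (s / klScale klE0 J) ^ 2 := by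
  have hsum : ∑ j ∈ range (J + 1), (16 : ℝ) ^ j ≤ (16 : ℝ) ^ J * 16 / 15 := by
    rw [geom_sum_eq (by norm_num) (J + 1), pow_succ, show (16 : ℝ) - 1 = 15 by norm_num]
    exact div_le_div_of_nonneg_right (by linarith) (by norm_num)
  have hs : 0 ≤ 1024 * s ^ 2 := by positivity
  rw [show ∑ j ∈ range (J + 1), (s / klScale klE0 j) ^ 2 = 1024 * s ^ 2 * ∑ j ∈ range (J + 1), (16 : ℝ) ^ j by
    rw [mul_sum]; exact sum_congr rfl fun j _ => klds_sq_div_klScale_eq s j, klds_sq_div_klScale_eq]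
  calc 1024 * s ^ 2 * ∑ j ∈ range (J + 1), (16 : ℝ) ^ j ≤ 1024 * s ^ 2 * ((16 : ℝ) ^ J * 16 / 15) := mul_le_mul_of_nonneg_left hsum hs
    _ = 16 / 15 * (1024 * s ^ 2 * (16 : ℝ) ^ J) := by ring

/-! ## §2 The edge scales are at most `log₄(512·v)` many -/

/-- **Two edge scales are close**: if `j₁ ≤ j₂` are both in class for the step `s` (`s ≤ 4^{-j₂}`) and `j₁` is NOT deep (`Λ_{j₁}/16 < v·s`, `0 < v`), then
`4^{j₂ − j₁} < 512·v`. [folklore] -/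
theorem klds_pow_sub_lt_of_edge {s v : ℝ} (hv : 0 < v) {j₁ j₂ : ℕ} (hle : j₁ ≤ j₂) (hclass : s ≤ ((4 : ℝ) ^ j₂)⁻¹)
    (hedge : klScale klE0 j₁ / 16 < v * s) : (4 : ℝ) ^ (j₂ - j₁) < 512 * v := by
  have h2 : 0 < (4 : ℝ) ^ j₂ := by positivity
  have hΛ : klScale klE0 j₁ = 1 / 32 * ((4 : ℝ) ^ j₁)⁻¹ := by simp [klScale, klE0]
  rw [hΛ] at hedge
  -- `4^{-j₁} < 512 v s ≤ 512 v 4^{-j₂}`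
  have key : ((4 : ℝ) ^ j₁)⁻¹ < 512 * v * ((4 : ℝ) ^ j₂)⁻¹ := by
    have := mul_le_mul_of_nonneg_left hclass (by positivity : (0 : ℝ) ≤ 512 * v)
    linarith
  rw [pow_sub₀ _ (by norm_num) hle]
  calc (4 : ℝ) ^ j₂ * ((4 : ℝ) ^ j₁)⁻¹ < (4 : ℝ) ^ j₂ * (512 * v * ((4 : ℝ) ^ j₂)⁻¹) := mul_lt_mul_of_pos_left key h2
    _ = 512 * v := by field_simp

/-- **The edge scales are few**: `512·v ≤ 4^{m₀}` ⟹ every finite set of scales that are in class for `s` but not deep has at most `m₀` elements. [folklore] -/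
theorem klds_edge_card_le {s v : ℝ} (hv : 0 < v) {m₀ : ℕ} (hm₀ : 512 * v ≤ (4 : ℝ) ^ m₀) (E : Finset ℕ)
    (hE : ∀ j ∈ E, s ≤ ((4 : ℝ) ^ j)⁻¹ ∧ klScale klE0 j / 16 < v * s) : E.card ≤ m₀ := by
  rcases E.eq_empty_or_nonempty with h | h
  · simp [h]
  · set j₁ := E.min' h with hj₁
    have hsub : E ⊆ Finset.Ico j₁ (j₁ + m₀) := by
      intro j hj
      have hle : j₁ ≤ j := E.min'_le j hj
      have hlt := klds_pow_sub_lt_of_edge hv hle (hE j hj).1 (hE j₁ (E.min'_mem h)).2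
      have h4 : (4 : ℝ) ^ (j - j₁) < (4 : ℝ) ^ m₀ := hlt.trans_le hm₀
      have hjm : j - j₁ < m₀ := (pow_lt_pow_iff_right₀ (by norm_num : (1 : ℝ) < 4)).1 h4
      rw [Finset.mem_Ico]
      omega
    exact (Finset.card_le_card hsub).trans (by simp)

/-! ## §3 The shortfall by shape -/

/-- **The shortfall (D2) by shape**: deep moduli `W_0(j) − W_q(j) ≤ C·(s/Λ_j)²` for `j ≤ J` (`0 ≤ C`) and edge bounds `W_0(j) − W_q(j) ≤ 2b` for `J < j < m` (`0 ≤ b`)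
give `Σ_{j<m}(W_0(j) − W_q(j)) ≤ (16/15)·C·(s/Λ_J)² + 2b·(m − (J+1))`. [folklore] -/
theorem klds_shortfall_le (W₀ Wq : ℕ → ℝ) {C s b : ℝ} (hC : 0 ≤ C) (hb : 0 ≤ b) (J m : ℕ)
    (hdeep : ∀ j ≤ J, W₀ j - Wq j ≤ C * (s / klScale klE0 j) ^ 2) (hedge : ∀ j, J < j → j < m → W₀ j - Wq j ≤ 2 * b) :
    ∑ j ∈ range m, (W₀ j - Wq j) ≤ 16 / 15 * C * (s / klScale klE0 J) ^ 2 + 2 * b * (((m - (J + 1) : ℕ) : ℝ)) := by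
  -- split `range m` at `J + 1`
  have hsplit : ∑ j ∈ range m, (W₀ j - Wq j) =
      ∑ j ∈ (range m).filter (fun j => j ≤ J), (W₀ j - Wq j) + ∑ j ∈ (range m).filter (fun j => ¬ j ≤ J), (W₀ j - Wq j) :=
    (sum_filter_add_sum_filter_not _ _ _).symm
  rw [hsplit]
  refine add_le_add ?_ ?_
  · -- deep part: each term `≤ C (s/Λ_j)²`, nonneg majorants, subset of `range (J+1)`
    calc ∑ j ∈ (range m).filter (fun j => j ≤ J), (W₀ j - Wq j)
        ≤ ∑ j ∈ (range m).filter (fun j => j ≤ J), C * (s / klScale klE0 j) ^ 2 :=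
          sum_le_sum fun j hj => hdeep j (mem_filter.1 hj).2
      _ ≤ ∑ j ∈ range (J + 1), C * (s / klScale klE0 j) ^ 2 := by
          refine sum_le_sum_of_subset_of_nonneg (fun j hj => ?_) fun j _ _ => by positivity
          rw [mem_filter] at hj
          exact mem_range.2 (by omega)
      _ = C * ∑ j ∈ range (J + 1), (s / klScale klE0 j) ^ 2 := (mul_sum _ _ _).symm
      _ ≤ C * (16 / 15 * (s / klScale klE0 J) ^ 2) := mul_le_mul_of_nonneg_left (klds_sum_sq_div_klScale_le s J) hC
      _ = 16 / 15 * C * (s / klScale klE0 J) ^ 2 := by ring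
  · -- edge part: at most `m − (J+1)` terms, each `≤ 2b`
    have hcard : ((range m).filter (fun j => ¬ j ≤ J)).card ≤ m - (J + 1) := by
      have hsub : (range m).filter (fun j => ¬ j ≤ J) ⊆ Finset.Ico (J + 1) m := by
        intro j hj
        rw [mem_filter, mem_range] at hj
        rw [Finset.mem_Ico]
        omega
      exact (Finset.card_le_card hsub).trans (by simp)
    calc ∑ j ∈ (range m).filter (fun j => ¬ j ≤ J), (W₀ j - Wq j)
        ≤ ∑ j ∈ (range m).filter (fun j => ¬ j ≤ J), 2 * b := by
          refine sum_le_sum fun j hj => ?_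
          rw [mem_filter, mem_range] at hj
          exact hedge j (by omega) hj.1
      _ = ((range m).filter (fun j => ¬ j ≤ J)).card * (2 * b) := by rw [sum_const, nsmul_eq_mul]
      _ ≤ ((m - (J + 1) : ℕ) : ℝ) * (2 * b) := by
          exact mul_le_mul_of_nonneg_right (by exact_mod_cast hcard) (by positivity)
      _ = 2 * b * (((m - (J + 1) : ℕ) : ℝ)) := by ring

end Summit.HubbardSuperconductivity.HubbardSuperconductivity.Theorems.KLRegimeSplit

end
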